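import Summits.CriticalPhenomena.CardyFormulaZ2.Theorems.CardyAnchoredRigidityStretchedPullbackNotTargetBlindHalfDiscChart
import Summits.CriticalPhenomena.CardyFormulaZ2.Theorems.CardyAnchoredRigidityStretchedPullbackNotTargetBlindSymmetricChart

/-!
# Symmetric charts based at `1`: uniformizing data with an explicit boundary correspondence

Helper file for route CardyAnchoredRigidity, item stmt-CriticalPhenomena-14488
(`StretchedPullbackNotTargetBlind`).

`SymChart U` packages the output of `exists_symmetricChart` for a domain `U ⊆ ℍ` whose boundary
contains the real segment `(-7, 9)` as a free arc (base point `1`, radius `8`): a map `G`,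
holomorphic on a symmetric open set `E ⊇ U ∪ B(1, 8)`, bijective `E → 𝔻` and `U → 𝔻⁺`, real and
strictly increasing on `(-7, 9)` with `G 1 = 0`, `G'(1) = c > 0`. Composing `G⁻¹ : 𝔻⁺ → U` with the
explicit half-disc chart `halfDiscChart : ℍ → 𝔻⁺` gives a uniformizing map `SymChart.unif : ℍ → U`
in the tree's sense whose boundary value at the real point `diamParam (Re G t)` is `t`, for EVERY
`t ∈ (-7, 9)` (`SymChart.hasBoundaryValue`) — no Carathéodory theory needed, since these boundary
points of `U` are interior points of `E`. Finally, first-order bounds for `Re G (1 + d)` as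
`d ↓ 0` from `G'(1) = c` (`SymChart.re_le_two_mul`, `SymChart.half_mul_le_re`). No named facts.
-/

noncomputable section

open Set Filter Metric Topology Complex Function
open UpperHalfPlane (upperHalfPlaneSet isOpen_upperHalfPlaneSet)

namespace Summit.CriticalPhenomena.CardyFormulaZ2.Theorems.StretchedPullback

/-- **A symmetric chart based at `1` with radius `8`** of a domain `U ⊆ ℍ` (the data produced by
`exists_symmetricChart` with `x = 1`, `r = 8`). -/
structure SymChart (U : Set ℂ) where
  /-- The symmetric open set `E ⊇ U ∪ B(1, 8)` on which the chart is holomorphic. -/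
  E : Set ℂ
  /-- The chart. -/
  G : ℂ → ℂ
  /-- The derivative of the chart at the base point `1` (a positive real). -/
  c : ℝ
  hUE : U ⊆ E
  hBE : ball ((1 : ℝ) : ℂ) 8 ⊆ E
  hGE : DifferentiableOn ℂ G E
  hbijE : BijOn G E (ball 0 1)
  hbijU : BijOn G U halfDisc
  hinvE : DifferentiableOn ℂ (invFunOn G E) (ball 0 1)
  hinvEq : EqOn (invFunOn G U) (invFunOn G E) halfDisc
  hinvU : DifferentiableOn ℂ (invFunOn G U) halfDisc
  hG1 : G ((1 : ℝ) : ℂ) = 0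
  hc : 0 < c
  hGd : HasDerivAt G (c : ℂ) ((1 : ℝ) : ℂ)
  hreal : ∀ t : ℝ, (t : ℂ) ∈ ball ((1 : ℝ) : ℂ) 8 → (G t).im = 0
  hmono : StrictMonoOn (fun t : ℝ => (G t).re) (Ioo (1 - 8) (1 + 8))

/-- **Existence of symmetric charts** for an open connected `U ⊆ ℍ` with the square-root property
containing the half-disc `B(1, 8) ∩ ℍ`. -/
theorem exists_symChart {U : Set ℂ} (hU : IsOpen U) (hUc : IsPreconnected U) (hsq : HasSqrt U)
    (hUH : U ⊆ upperHalfPlaneSet) (hB : ball ((1 : ℝ) : ℂ) 8 ∩ upperHalfPlaneSet ⊆ U) :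
    Nonempty (SymChart U) := by
  obtain ⟨E, G, -, hUE, hBE, hGE, hbijE, hbijU, hinvE, hinvEq, hinvU, hG1, ⟨c, hc, hGd⟩, hreal,
    hmono⟩ := exists_symmetricChart hU hUc hsq hUH (x := 1) (r := 8) (by norm_num) hB
  exact ⟨⟨E, G, c, hUE, hBE, hGE, hbijE, hbijU, hinvE, hinvEq, hinvU, hG1, hc, hGd, hreal, hmono⟩⟩

namespace SymChart

variable {U : Set ℂ} (Γ : SymChart U)

/-- A real point `t` with `|t - 1| < 8` lies in `B(1, 8) ⊆ E`. -/
theorem ofReal_mem_ball {t : ℝ} (ht : t ∈ Ioo (-7 : ℝ) 9) : (t : ℂ) ∈ ball ((1 : ℝ) : ℂ) 8 := by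
  rw [mem_ball, dist_eq_norm, ← ofReal_sub, norm_real, Real.norm_eq_abs, abs_lt]
  constructor <;> linarith [ht.1, ht.2]

/-- The chart is holomorphic on `U`. -/
theorem differentiableOn_U : DifferentiableOn ℂ Γ.G U := Γ.hGE.mono Γ.hUE

/-- The chart is real on the free segment. -/
theorem im_eq_zero {t : ℝ} (ht : t ∈ Ioo (-7 : ℝ) 9) : (Γ.G t).im = 0 :=
  Γ.hreal t (ofReal_mem_ball ht)

/-- On the free segment the chart value is the real number `Re G t`. -/
theorem apply_ofReal_eq {t : ℝ} (ht : t ∈ Ioo (-7 : ℝ) 9) : Γ.G t = (((Γ.G t).re : ℝ) : ℂ) := by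
  apply Complex.ext
  · simp
  · rw [ofReal_im, Γ.im_eq_zero ht]

/-- The chart maps the free segment into the unit disc. -/
theorem norm_lt_one {t : ℝ} (ht : t ∈ Ioo (-7 : ℝ) 9) : ‖Γ.G t‖ < 1 :=
  mem_ball_zero_iff.1 (Γ.hbijE.mapsTo (Γ.hBE (ofReal_mem_ball ht)))

/-- `Re G t ∈ (-1, 1)` on the free segment. -/
theorem re_mem_Ioo {t : ℝ} (ht : t ∈ Ioo (-7 : ℝ) 9) : (Γ.G t).re ∈ Ioo (-1 : ℝ) 1 := by
  have h := (abs_re_le_norm (Γ.G t)).trans_lt (Γ.norm_lt_one ht)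
  exact abs_lt.1 h

/-- `Re G 1 = 0`. -/
theorem re_one : (Γ.G ((1 : ℝ) : ℂ)).re = 0 := by rw [Γ.hG1, zero_re]

/-- `Re G` is strictly increasing on `(-7, 9)`. -/
theorem strictMonoOn_re : StrictMonoOn (fun t : ℝ => (Γ.G t).re) (Ioo (-7) 9) := by
  have h := Γ.hmono
  norm_num at h
  exact h

/-- `Re G t > 0` for `t ∈ (1, 9)`. -/
theorem re_pos {t : ℝ} (ht : t ∈ Ioo (1 : ℝ) 9) : 0 < (Γ.G t).re := by
  have h := Γ.strictMonoOn_re ⟨by norm_num, by norm_num⟩ ⟨by linarith [ht.1], ht.2⟩ ht.1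
  simp only at h
  rwa [Γ.re_one] at h

/-- **The uniformizing map attached to the chart**: `ℍ → 𝔻⁺ → U`. -/
def unif : Literature.Probability.RandomPlanarGeometry.ConformalEquiv upperHalfPlaneSet U :=
  halfDiscChart.trans
    (Literature.Probability.RandomPlanarGeometry.ConformalEquiv.ofBijOn Γ.G Γ.differentiableOn_U
      Γ.hbijU Γ.hinvU).symm

/-- The uniformizing map acts as `invFunOn G U ∘ halfDiscChart`. -/
theorem unif_apply (z : ℂ) : Γ.unif z = invFunOn Γ.G U (halfDiscChart z) := rfl

/-- **Boundary values of the uniformizing map on the free segment**: for every `t ∈ (-7, 9)`,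
`Γ.unif z → t` as `z → diamParam (Re G t)` in `ℍ`. -/
theorem hasBoundaryValue {t : ℝ} (ht : t ∈ Ioo (-7 : ℝ) 9) :
    Γ.unif.HasBoundaryValue (diamParam (Γ.G t).re : ℝ) t := by
  unfold Literature.Probability.RandomPlanarGeometry.ConformalEquiv.HasBoundaryValue
  set p : ℂ := (((Γ.G t).re : ℝ) : ℂ) with hp
  have hpG : Γ.G t = p := Γ.apply_ofReal_eq ht
  have hpball : p ∈ ball (0 : ℂ) 1 := by
    rw [← hpG]; exact mem_ball_zero_iff.2 (Γ.norm_lt_one ht)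
  -- the half-disc chart tends to `p` within the half-disc
  have h1 : Tendsto halfDiscChart (𝓝[upperHalfPlaneSet] ((diamParam (Γ.G t).re : ℝ) : ℂ))
      (𝓝[halfDisc] p) := by
    refine tendsto_nhdsWithin_iff.2 ⟨halfDiscChart_hasBoundaryValue (Γ.re_mem_Ioo ht), ?_⟩
    filter_upwards [self_mem_nhdsWithin] with z hz using halfDiscChart_mem hz
  -- the inverse chart is continuous at the interior point `p` of the disc, with value `t`
  have h2 : Tendsto (invFunOn Γ.G U) (𝓝[halfDisc] p) (𝓝 (t : ℂ)) := by
    have hcont : ContinuousAt (invFunOn Γ.G Γ.E) p :=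
      Γ.hinvE.continuousOn.continuousAt (isOpen_ball.mem_nhds hpball)
    have hval : invFunOn Γ.G Γ.E p = t := by
      rw [← hpG]
      exact Γ.hbijE.invOn_invFunOn.1 (Γ.hBE (ofReal_mem_ball ht))
    have h3 : Tendsto (invFunOn Γ.G Γ.E) (𝓝[halfDisc] p) (𝓝 (t : ℂ)) := by
      rw [← hval]
      exact hcont.tendsto.mono_left nhdsWithin_le_nhds
    exact h3.congr' (eventuallyEq_nhdsWithin_of_eqOn Γ.hinvEq).symm
  exact h2.comp h1

/-! ### First-order behaviour of `Re G` at the base point -/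

/-- A quantitative form of `G'(1) = c`: `|G (1 + d) - d c| ≤ ε |d|` for real `|d| < ρ`. -/
theorem exists_bound_sub_linear {ε : ℝ} (hε : 0 < ε) :
    ∃ ρ > 0, ∀ d : ℝ, |d| < ρ → ‖Γ.G ((1 + d : ℝ) : ℂ) - d * Γ.c‖ ≤ ε * |d| := by
  have h := (hasDerivAt_iff_isLittleO_nhds_zero.1 Γ.hGd).def hε
  rw [Metric.eventually_nhds_iff] at h
  obtain ⟨ρ, hρ, h⟩ := h
  refine ⟨ρ, hρ, fun d hd => ?_⟩
  have h1 := h (y := (d : ℂ)) (by rwa [dist_zero_right, norm_real, Real.norm_eq_abs])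
  rw [Γ.hG1, sub_zero, smul_eq_mul, norm_real, Real.norm_eq_abs] at h1
  push_cast
  rwa [mul_comm (d : ℂ)] at h1 ⊢

/-- Upper first-order bound: `Re G (1 + d) ≤ 2 c d` for small `d > 0`. -/
theorem re_le_two_mul : ∃ ρ > 0, ∀ d : ℝ, 0 < d → d < ρ →
    (Γ.G ((1 + d : ℝ) : ℂ)).re ≤ 2 * Γ.c * d := by
  obtain ⟨ρ, hρ, h⟩ := Γ.exists_bound_sub_linear Γ.hc
  refine ⟨ρ, hρ, fun d hd hdρ => ?_⟩
  have h1 := h d (by rwa [abs_of_pos hd])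
  rw [abs_of_pos hd] at h1
  have h2 : (Γ.G ((1 + d : ℝ) : ℂ) - d * Γ.c).re ≤ Γ.c * d := (re_le_norm _).trans h1
  have h3 : (Γ.G ((1 + d : ℝ) : ℂ) - d * Γ.c).re = (Γ.G ((1 + d : ℝ) : ℂ)).re - d * Γ.c := by
    simp [sub_re, mul_re]
  rw [h3] at h2
  linarith

/-- Lower first-order bound: `(c/2) d ≤ Re G (1 + d)` for small `d > 0`. -/
theorem half_mul_le_re : ∃ ρ > 0, ∀ d : ℝ, 0 < d → d < ρ →
    Γ.c / 2 * d ≤ (Γ.G ((1 + d : ℝ) : ℂ)).re := by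
  obtain ⟨ρ, hρ, h⟩ := Γ.exists_bound_sub_linear (half_pos Γ.hc)
  refine ⟨ρ, hρ, fun d hd hdρ => ?_⟩
  have h1 := h d (by rwa [abs_of_pos hd])
  rw [abs_of_pos hd] at h1
  have h2 : -(Γ.c / 2 * d) ≤ (Γ.G ((1 + d : ℝ) : ℂ) - d * Γ.c).re := by
    have := (abs_re_le_norm (Γ.G ((1 + d : ℝ) : ℂ) - d * Γ.c)).trans h1
    have := (abs_le.1 this).1
    linarith
  have h3 : (Γ.G ((1 + d : ℝ) : ℂ) - d * Γ.c).re = (Γ.G ((1 + d : ℝ) : ℂ)).re - d * Γ.c := by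
    simp [sub_re, mul_re]
  rw [h3] at h2
  linarith

end SymChart

end Summit.CriticalPhenomena.CardyFormulaZ2.Theorems.StretchedPullback
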